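import Mathlib
import Summits.ResolutionOfSingularities.ResolutionOfSingularities.Theorems.RadicialJungCleanModelsCleanPatchingDefs
import Summits.ResolutionOfSingularities.ResolutionOfSingularities.Theorems.RadicialJungCleanModelsStubLeibnizObstruction
import Literature.AlgebraicGeometry.Resolution.BlowupChartRsop
import Literature.AlgebraicGeometry.Resolution.WeakJacobianDerivations
import Literature.FieldTheory.Separability.FormallySmoothAlgebraic
import HarnessLib

/-!
# Route `RadicialJung`, crux `CleanModels` (stmt-ResolutionOfSingularities-15917), line `Sketch` rev 14, stub 4d
# `stub_cleanPointBlowup`: the chart computation, I (abstract chart data, the Leibniz obstruction, form (2))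

Commutative algebra behind «cleanness survives closed-point blow-ups» (Piltant 2013, Axiom 2 (ii) at closed points for
the regularity property `P_clean` of `RadicialJungCleanModelsCleanPatchingDefs.lean`; res-B-lens-1 g2 ADDENDUM A §3.1):
`R` a regular local ring with regular system of parameters `t : Fin d → R`, and ABSTRACT CHART DATA of the blowing up of
`Spec R` at its closed point in the `t_j`-chart, in the format of `BlowupChartRsop.lean` (a ring `A`, structure map
`ψ : R → A`, fractions `u_i` with `ψ(t_i) = ψ(t_j) u_i`, `ψ(t_j)` a non-zero-divisor, an isomorphism
`ε : (R/𝔪)[T_i : i ≠ j] ≅ A/(ψ t_j)` — the exceptional divisor of the chart is an affine space over the residue field —,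
a prime `𝔓 ⊆ A` over `𝔪`, and a local ring `L = A_𝔓` read in a ring `F'` through `f' : L → F'`).  PROVED here:

* `looseCleanForm_one_of_isRsopPart` — loose clean form (1) from a PART of a regular system of parameters (`IsRsopPart`);
* `derivation_apply_mul_prod_pow_eq` — the Euler-type computation `D(x ∏ yᵢ^{aᵢ}) = a_{i₀} · x ∏ yᵢ^{aᵢ}` for a derivation
  killing `x` and the `yᵢ`, `i ≠ i₀`, with `D y_{i₀} = y_{i₀}`;
* `exists_rep_twist` — twisting a non-trivial representative `Σ c_j^p G^j` of the `F^p`-line of `G` by `p`-th powers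
  (`e^p X - dd^p`, `e ≠ 0`) gives a non-trivial representative;
* `sub_pow_notMem_sq_of_chart` — the Leibniz obstruction (`stub_leibnizObstruction`, Stacks 07PF) read on the chart: if a
  derivation of `(R/𝔪)[T]` does not vanish, at the point, on the reduction of `b ∈ A` modulo `ψ(t_j)`, then
  `b - c^p ∈ 𝔪_L` forces `b - c^p ∉ 𝔪_L²`; `looseCleanForm_unit_of_chart` — hence such a unit `b` is loosely clean
  (form (2) or (3));
* `looseCleanForm_chart_of_form_two` — **form (2) survives**: a unit `u` whose residue is not a `p`-th power stays loosely
  clean at `L` (a derivation of the residue field with `D₀ ū = 1`, `exists_derivation_apply_eq_one_of_forall_pow_ne` — the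
  `p`-basis theorem in its weakest form —, extended coefficientwise to `(R/𝔪)[T]`, `MvPolynomial.exists_derivation_C_eq_X_eq`).

Form (1) and the Rees-chart specialisation are in `RadicialJungCleanModelsCleanPointBlowupChartFormOne.lean`; the scheme-level
statement (stalks of an `IsBlowup` along the reduced closed point) in `RadicialJungCleanModelsStubCleanPointBlowup.lean`.
Honest framing: nothing here proves resolution in characteristic `p` or any case of `CleanModels`.
-/

noncomputable section

set_option linter.dupNamespace false -- mandated namespace of this single-conjunct summit

open IsLocalRing MvPolynomial
open Literature.AlgebraicGeometry.Resolution

namespace Summit.ResolutionOfSingularities.ResolutionOfSingularities.Theorems.RadicialJung.CleanModels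

universe u

/-! ## Loose clean form (1) from a part of a regular system of parameters -/

/-- **Form (1) from a part of a regular system of parameters.** If `z : Fin n → L` (`0 < n`) is part of a regular system
of parameters of the local ring `L`, `u` is a unit and `p ∤ a_i`, then `f'(u ∏ z_i^{a_i})` has loose clean form (1)
(complete `z` to a minimal basis `(z, y)` of `𝔪_L`, `IsRsopPart.exists_rsop`). [folklore] -/
theorem looseCleanForm_one_of_isRsopPart (p : ℕ) {L F' : Type*} [CommRing L] [IsLocalRing L] [CommRing F']
    (f' : L →+* F') {n : ℕ} {z : Fin n → L} (hz : IsRsopPart z) (hn : 0 < n) (a : Fin n → ℕ)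
    (ha : ∀ i, ¬ p ∣ a i) {u : L} (hu : IsUnit u) {Y : F'} (hY : Y = f' (u * ∏ i, z i ^ a i)) :
    LooseCleanForm p f' Y := by
  haveI := hz.isRegularLocalRing
  obtain ⟨e, x, hrank, hspan, hx⟩ := hz.exists_rsop
  refine Or.inl ⟨n + e, n, Nat.le_add_right n e, x, a, u, hu, hspan, ?_, hn, ha, ?_⟩
  · have h := IsRegularLocalRing.spanFinrank_maximalIdeal (R := L)
    rw [hrank] at h
    exact h.symm
  · rw [hY]
    congr 2
    refine Finset.prod_congr rfl fun i _ => ?_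
    rw [← hx i]
    rfl

/-! ## An Euler-type derivation computation -/

/-- **`D(x ∏ᵢ yᵢ^{aᵢ}) = a_{i₀} · x ∏ᵢ yᵢ^{aᵢ}`** for a derivation `D` with `D x = 0`, `D y_{i₀} = y_{i₀}` and `D yᵢ = 0`
for `i ≠ i₀` (the weighted Euler identity for the weight concentrated at `i₀`). [folklore] -/
theorem derivation_apply_mul_prod_pow_eq {E : Type*} [CommRing E] (D : Derivation ℤ E E) {m : ℕ} (y : Fin m → E)
    (a : Fin m → ℕ) (i₀ : Fin m) (hy : ∀ i, D (y i) = if i = i₀ then y i else 0) {x : E} (hx : D x = 0) :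
    D (x * ∏ i, y i ^ a i) = (a i₀ : E) * (x * ∏ i, y i ^ a i) := by
  classical
  -- on sub-products: `D (∏_{i ∈ s} yᵢ^{aᵢ}) = [i₀ ∈ s] a_{i₀} ∏_{i ∈ s} yᵢ^{aᵢ}`
  have key : ∀ s : Finset (Fin m),
      D (∏ i ∈ s, y i ^ a i) = (if i₀ ∈ s then (a i₀ : E) else 0) * ∏ i ∈ s, y i ^ a i := by
    intro s
    induction s using Finset.induction_on with
    | empty => simp
    | insert i s hi ih =>
      rw [Finset.prod_insert hi, Derivation.leibniz, ih, Derivation.leibniz_pow, hy i, smul_eq_mul, smul_eq_mul]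
      by_cases h : i = i₀
      · subst h
        have hs : ¬ i ∈ s := hi
        rw [if_pos rfl, if_neg hs, if_pos (Finset.mem_insert_self i s), zero_mul, mul_zero, zero_add]
        rcases Nat.eq_zero_or_pos (a i) with h0 | hpos
        · rw [h0]; simp
        · simp only [smul_eq_mul, nsmul_eq_mul]
          rw [show (y i ^ (a i - 1) * y i : E) = y i ^ a i by rw [← pow_succ, Nat.sub_add_cancel hpos]]
          ring
      · rw [if_neg h, smul_zero, smul_zero, mul_zero, add_zero]
        by_cases h0 : i₀ ∈ s
        · rw [if_pos h0, if_pos (Finset.mem_insert_of_mem h0)]; ring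
        · have : ¬ i₀ ∈ insert i s := by
            rw [Finset.mem_insert]
            rintro (h1 | h1)
            · exact h h1.symm
            · exact h0 h1
          rw [if_neg h0, if_neg this]; ring
  rw [Derivation.leibniz, hx, smul_zero, add_zero, key Finset.univ, if_pos (Finset.mem_univ _), smul_eq_mul]
  ring

/-! ## Non-trivial representatives of the `F^p`-line: twisting by `p`-th powers -/

/-- **Twists of non-trivial representatives.** If `∑ⱼ cⱼ^p G^j` is a non-trivial representative of the `F^p`-line of `G`
(`cⱼ ≠ 0` for some `j ≠ 0`), then so is `e^p (∑ⱼ cⱼ^p G^j) - dd^p` for `e ≠ 0` (coefficients `e cⱼ`, and `e c₀ - dd` in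
degree `0`; freshman's dream in characteristic `p`). [folklore] -/
theorem exists_rep_twist {F : Type*} [Field F] (p : ℕ) [hp : Fact p.Prime] [CharP F p] (G : F) (c : Fin p → F)
    (hc : ∃ j : Fin p, (j : ℕ) ≠ 0 ∧ c j ≠ 0) (e dd : F) (he : e ≠ 0) :
    ∃ c' : Fin p → F, (∃ j : Fin p, (j : ℕ) ≠ 0 ∧ c' j ≠ 0) ∧
      (∑ j : Fin p, c' j ^ p * G ^ (j : ℕ)) = e ^ p * (∑ j : Fin p, c j ^ p * G ^ (j : ℕ)) - dd ^ p := by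
  classical
  let z : Fin p := ⟨0, hp.out.pos⟩
  refine ⟨fun j => if j = z then e * c j - dd else e * c j, ?_, ?_⟩
  · obtain ⟨j, hj, hcj⟩ := hc
    refine ⟨j, hj, ?_⟩
    have hjz : j ≠ z := fun h => hj (by rw [h])
    simp only [hjz, if_false]
    exact mul_ne_zero he hcj
  · rw [Finset.mul_sum, Finset.sum_eq_add_sum_sdiff_singleton_of_mem (Finset.mem_univ z),
      Finset.sum_eq_add_sum_sdiff_singleton_of_mem (Finset.mem_univ z) (fun j => e ^ p * (c j ^ p * G ^ (j : ℕ)))]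
    beta_reduce
    rw [if_pos rfl]
    have h1 : ∑ j ∈ Finset.univ \ {z}, (if j = z then e * c j - dd else e * c j) ^ p * G ^ (j : ℕ) =
        ∑ j ∈ Finset.univ \ {z}, e ^ p * (c j ^ p * G ^ (j : ℕ)) := by
      refine Finset.sum_congr rfl fun j hj => ?_
      have hjz : j ≠ z := by simpa using hj
      rw [if_neg hjz, mul_pow]; ring
    rw [h1, sub_pow_char, mul_pow]
    have hz0 : ((z : ℕ)) = 0 := rfl
    rw [hz0, pow_zero, mul_one, mul_one]
    ring

/-! ## Abstract chart data of the blowing up of a regular local ring at its closed point -/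

section AbstractChart

variable {R : Type u} [CommRing R] [IsRegularLocalRing R] {d : ℕ} (t : Fin d → R) (j : Fin d)
  (hspan : Ideal.span (Set.range t) = maximalIdeal R) (hdim : ringKrullDim R = (d : WithBot ℕ∞))
  {A : Type u} [CommRing A] (ψ : R →+* A) (uA : Fin d → A)
  (hrel : ∀ i, ψ (t i) = ψ (t j) * uA i) (hnzd : ψ (t j) ∈ nonZeroDivisors A)
  (ε : MvPolynomial {i : Fin d // i ≠ j} (R ⧸ Ideal.span (Set.range t)) ≃+* A ⧸ Ideal.span {ψ (t j)})
  (hεC : ∀ r : R, ε (C (Ideal.Quotient.mk (Ideal.span (Set.range t)) r)) = Ideal.Quotient.mk _ (ψ r))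
  (hεX : ∀ i : {i : Fin d // i ≠ j}, ε (X i) = Ideal.Quotient.mk _ (uA i.1))
  (𝔓 : Ideal A) [𝔓.IsPrime] (h𝔓 : 𝔓.comap ψ = maximalIdeal R)
  (L : Type u) [CommRing L] [IsLocalRing L] [Algebra A L] [IsLocalization.AtPrime L 𝔓]
  (p : ℕ) [hp : Fact p.Prime]

include hdim in
/-- `emb dim R = d` (as `d + 0`, the shape consumed by `isRsopPart_chartFamily` with no further parameters `w`).
[folklore] -/
theorem spanFinrank_eq_add_zero : (maximalIdeal R).spanFinrank = d + 0 := by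
  have h := IsRegularLocalRing.spanFinrank_maximalIdeal (R := R)
  rw [hdim] at h
  exact_mod_cast h

include hspan in
/-- The regular system of parameters `t` followed by the empty family generates `𝔪`. [folklore] -/
theorem span_range_append_elim0 : Ideal.span (Set.range (Fin.append t Fin.elim0)) = maximalIdeal R := by
  rw [Fin.append_elim0]
  have hsurj : Function.Surjective (Fin.cast (Nat.add_zero d)) := fun i =>
    ⟨Fin.cast (Nat.add_zero d).symm i, Fin.ext rfl⟩
  rw [hsurj.range_comp, hspan]

include hspan h𝔓 in
omit [𝔓.IsPrime] in
/-- `ψ r ∈ 𝔓 ↔ r ∈ 𝔪_R`. [folklore] -/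
theorem map_mem_chartPrime_iff (r : R) : ψ r ∈ 𝔓 ↔ r ∈ Ideal.span (Set.range t) := by
  rw [hspan, ← h𝔓, Ideal.mem_comap]

include hspan h𝔓 in
omit [𝔓.IsPrime] in
/-- `ψ(t_i) ∈ 𝔓`. [folklore] -/
theorem map_rsop_mem_chartPrime (i : Fin d) : ψ (t i) ∈ 𝔓 :=
  (map_mem_chartPrime_iff t hspan ψ 𝔓 h𝔓 (t i)).mpr (Ideal.subset_span ⟨i, rfl⟩)

include hrel hnzd in
omit [IsRegularLocalRing R] in
/-- `u_j = 1` (`ψ(t_j) = ψ(t_j) u_j` with `ψ(t_j)` a non-zero-divisor). [folklore] -/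
theorem chartFrac_self : uA j = 1 :=
  (mul_cancel_left_mem_nonZeroDivisors hnzd).mp (by rw [mul_one]; exact (hrel j).symm)

include hspan in
/-- The residue ring `R/(t) = R/𝔪` is a field: `(t)` is maximal. [folklore] -/
theorem isMaximal_span_rsop : (Ideal.span (Set.range t)).IsMaximal := by
  rw [hspan]; exact maximalIdeal.isMaximal R

include hspan in
/-- `R/(t)` has characteristic `p` if `R` has. [folklore] -/
theorem charP_quotient_span_rsop [CharP R p] : CharP (R ⧸ Ideal.span (Set.range t)) p := by
  haveI := isDomain_of_isRegularLocalRing R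
  haveI : Nontrivial (R ⧸ Ideal.span (Set.range t)) :=
    Ideal.Quotient.nontrivial_iff.mpr (isMaximal_span_rsop t hspan).ne_top
  exact CharP.of_ringHom_of_ne_zero (Ideal.Quotient.mk _) p hp.out.ne_zero

/-! ### The reduction map `A → A/(ψ t_j) ≅ (R/𝔪)[T]` and the prime of the point on the exceptional chart -/

omit [IsRegularLocalRing R] in
/-- The reduction map `A → (R/𝔪)[T_i : i ≠ j]` is surjective. [folklore] -/
theorem chartReduction_surjective :
    Function.Surjective (ε.symm.toRingHom.comp (Ideal.Quotient.mk (Ideal.span {ψ (t j)}))) :=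
  ε.symm.surjective.comp Ideal.Quotient.mk_surjective

include hεC in
omit [IsRegularLocalRing R] in
/-- The reduction map on `ψ(r)` is the constant `r̄`. [folklore] -/
theorem chartReduction_map (r : R) :
    (ε.symm.toRingHom.comp (Ideal.Quotient.mk (Ideal.span {ψ (t j)}))) (ψ r) =
      C (Ideal.Quotient.mk (Ideal.span (Set.range t)) r) := by
  rw [RingHom.comp_apply, RingEquiv.toRingHom_eq_coe, RingEquiv.coe_toRingHom, RingEquiv.symm_apply_eq, hεC]

include hεX in
omit [IsRegularLocalRing R] in
/-- The reduction map on the fraction `u_i` (`i ≠ j`) is the variable `T_i`. [folklore] -/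
theorem chartReduction_frac (i : {i : Fin d // i ≠ j}) :
    (ε.symm.toRingHom.comp (Ideal.Quotient.mk (Ideal.span {ψ (t j)}))) (uA i.1) = X i := by
  rw [RingHom.comp_apply, RingEquiv.toRingHom_eq_coe, RingEquiv.coe_toRingHom, RingEquiv.symm_apply_eq, hεX]

include hspan h𝔓 in
/-- **The prime of the point on the exceptional chart**: a prime `Q` of `(R/𝔪)[T]` pulling back to `𝔓` along the
reduction map (the image of `𝔓 ⊇ (ψ t_j)`). [folklore] -/
theorem exists_prime_comap_chartReduction :
    ∃ Q : Ideal (MvPolynomial {i : Fin d // i ≠ j} (R ⧸ Ideal.span (Set.range t))), Q.IsPrime ∧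
      Q.comap (ε.symm.toRingHom.comp (Ideal.Quotient.mk (Ideal.span {ψ (t j)}))) = 𝔓 := by
  set φE := ε.symm.toRingHom.comp (Ideal.Quotient.mk (Ideal.span {ψ (t j)})) with hφE
  have hsurj : Function.Surjective φE := chartReduction_surjective t j ψ ε
  have hker : RingHom.ker φE ≤ 𝔓 := by
    intro x hx
    rw [RingHom.mem_ker, hφE, RingHom.comp_apply, RingEquiv.toRingHom_eq_coe, RingEquiv.coe_toRingHom,
      EmbeddingLike.map_eq_zero_iff, Ideal.Quotient.eq_zero_iff_mem, Ideal.mem_span_singleton] at hx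
    obtain ⟨y, rfl⟩ := hx
    exact 𝔓.mul_mem_right _ (map_rsop_mem_chartPrime t hspan ψ 𝔓 h𝔓 j)
  refine ⟨𝔓.map φE, Ideal.map_isPrime_of_surjective hsurj hker, ?_⟩
  rw [Ideal.comap_map_of_surjective _ hsurj]
  exact sup_eq_left.mpr hker

/-! ### The Leibniz obstruction on the chart -/

include hspan in
/-- **The Leibniz obstruction read on the chart** (`stub_leibnizObstruction`, Stacks 07PF): if a derivation `D` of the
exceptional chart ring `(R/𝔪)[T_i : i ≠ j]` does not vanish, at the point `Q` over `𝔓`, on the reduction of `b ∈ A`, then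
`b - c^p ∈ 𝔪_L` forces `b - c^p ∉ 𝔪_L²` in `L = A_𝔓`. [cite: StacksProject, Tag 07PF] -/
theorem sub_pow_notMem_sq_of_chart [CharP R p]
    (Q : Ideal (MvPolynomial {i : Fin d // i ≠ j} (R ⧸ Ideal.span (Set.range t)))) [Q.IsPrime]
    (hQ : Q.comap (ε.symm.toRingHom.comp (Ideal.Quotient.mk (Ideal.span {ψ (t j)}))) = 𝔓)
    (D : Derivation ℤ (MvPolynomial {i : Fin d // i ≠ j} (R ⧸ Ideal.span (Set.range t)))
      (MvPolynomial {i : Fin d // i ≠ j} (R ⧸ Ideal.span (Set.range t))))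
    (b : A) (hDb : D ((ε.symm.toRingHom.comp (Ideal.Quotient.mk (Ideal.span {ψ (t j)}))) b) ∉ Q)
    (c₀ : L) (hc : algebraMap A L b - c₀ ^ p ∈ maximalIdeal L) :
    algebraMap A L b - c₀ ^ p ∉ maximalIdeal L ^ 2 := by
  haveI := charP_quotient_span_rsop t hspan p
  exact stub_leibnizObstruction _ p hp.out 𝔓 Q hQ D b hDb c₀ hc

include hspan in
/-- **A unit of `L` with the Leibniz property is loosely clean** (form (2) if no `b - c^p` lies in `𝔪_L`, else form (3)).
[folklore] -/
theorem looseCleanForm_unit_of_chart [CharP R p] {F' : Type*} [CommRing F'] (f' : L →+* F')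
    (Q : Ideal (MvPolynomial {i : Fin d // i ≠ j} (R ⧸ Ideal.span (Set.range t)))) [Q.IsPrime]
    (hQ : Q.comap (ε.symm.toRingHom.comp (Ideal.Quotient.mk (Ideal.span {ψ (t j)}))) = 𝔓)
    (D : Derivation ℤ (MvPolynomial {i : Fin d // i ≠ j} (R ⧸ Ideal.span (Set.range t)))
      (MvPolynomial {i : Fin d // i ≠ j} (R ⧸ Ideal.span (Set.range t))))
    (b : A) (hb : b ∉ 𝔓) (hDb : D ((ε.symm.toRingHom.comp (Ideal.Quotient.mk (Ideal.span {ψ (t j)}))) b) ∉ Q)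
    {Y : F'} (hY : Y = f' (algebraMap A L b)) : LooseCleanForm p f' Y := by
  have hunit : IsUnit (algebraMap A L b) := IsLocalization.map_units L (⟨b, hb⟩ : 𝔓.primeCompl)
  by_cases h : ∃ c₀ : L, algebraMap A L b - c₀ ^ p ∈ maximalIdeal L
  · obtain ⟨c₀, hc₀⟩ := h
    exact Or.inr (Or.inr ⟨algebraMap A L b, c₀, hY, hc₀,
      sub_pow_notMem_sq_of_chart t j hspan ψ ε 𝔓 L p Q hQ D b hDb c₀ hc₀⟩)
  · push Not at h
    exact Or.inr (Or.inl ⟨algebraMap A L b, hunit, hY, h⟩)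

/-! ### Form (2) survives -/

include hspan h𝔓 hεC in
/-- **Form (2) survives the blowing up.** If `u ∈ R` is a unit whose residue is not a `p`-th power (`u - c^p ∉ 𝔪_R` for
all `c`), then `f'(ψ u)` is loosely clean at `L`: either no `ψ(u) - c^p` lies in `𝔪_L` (form (2)), or such a difference is
a regular parameter (form (3)) — by the Leibniz obstruction with a derivation `D₀` of the residue field `R/𝔪` not killing
`ū` (`exists_derivation_apply_eq_one_of_forall_pow_ne`, the `p`-basis theorem in its weakest form) extended
coefficientwise to the exceptional chart `(R/𝔪)[T]` (`MvPolynomial.exists_derivation_C_eq_X_eq`).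
[cite: Piltant2013, §2 Axiom 2 (ii)] -/
theorem looseCleanForm_chart_of_form_two [CharP R p] {F' : Type*} [CommRing F'] (f' : L →+* F') {u : R}
    (hu : IsUnit u) (hup : ∀ c : R, u - c ^ p ∉ maximalIdeal R) {Y : F'}
    (hY : Y = f' (algebraMap A L (ψ u))) : LooseCleanForm p f' Y := by
  classical
  haveI := isMaximal_span_rsop t hspan
  letI : Field (R ⧸ Ideal.span (Set.range t)) := Ideal.Quotient.field _
  haveI := charP_quotient_span_rsop t hspan p
  obtain ⟨Q, hQprime, hQ⟩ := exists_prime_comap_chartReduction t j hspan ψ ε 𝔓 h𝔓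
  haveI := hQprime
  -- the residue `ū` is not a `p`-th power
  set ū : R ⧸ Ideal.span (Set.range t) := Ideal.Quotient.mk _ u with hū
  have hūp : ∀ b : R ⧸ Ideal.span (Set.range t), b ^ p ≠ ū := by
    intro b hb
    obtain ⟨c, rfl⟩ := Ideal.Quotient.mk_surjective b
    rw [hū, ← map_pow, Ideal.Quotient.eq, hspan] at hb
    exact hup c (by rw [← neg_sub]; exact Submodule.neg_mem _ hb)
  -- a derivation of the residue field with `D₀ ū = 1`, extended coefficientwise
  obtain ⟨D₀, hD₀⟩ :=
    Literature.FieldTheory.Separability.exists_derivation_apply_eq_one_of_forall_pow_ne p ū hūp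
  obtain ⟨D, hDC, -⟩ := MvPolynomial.exists_derivation_C_eq_X_eq (σ := {i : Fin d // i ≠ j})
    (T := MvPolynomial {i : Fin d // i ≠ j} (R ⧸ Ideal.span (Set.range t)))
    ((Algebra.linearMap (R ⧸ Ideal.span (Set.range t))
      (MvPolynomial {i : Fin d // i ≠ j} (R ⧸ Ideal.span (Set.range t)))).compDer D₀) (fun _ => 0)
  refine looseCleanForm_unit_of_chart t j hspan ψ ε 𝔓 L p f' Q hQ D (ψ u) ?_ ?_ hY
  · exact fun h => Ideal.IsPrime.ne_top' (Ideal.eq_top_of_isUnit_mem 𝔓 h (hu.map ψ))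
  · rw [chartReduction_map t j ψ ε hεC u]
    change D (C ū) ∉ Q
    rw [hDC]
    change Algebra.linearMap _ _ (D₀ ū) ∉ Q
    rw [hD₀, Algebra.linearMap_apply, map_one]
    exact Q.ne_top_iff_one.mp hQprime.ne_top

end AbstractChart

end Summit.ResolutionOfSingularities.ResolutionOfSingularities.Theorems.RadicialJung.CleanModels

end
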